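import Summits.HodgeConjecture.HodgeConjecture.Theorems.SiegelUniversalFamilyHodgeFrames
import Summits.HodgeConjecture.CorCM.HypDel.M1primeOfFU
import Literature.AlgebraicGeometry.ModuliOfAbelianVarieties.SiegelAdmissibleClassUnique
import Literature.AlgebraicGeometry.ModuliOfAbelianVarieties.SiegelFineModuliFibreTriples
import Literature.Topology.Euclidean.DimensionOfSmoothBijection
import Literature.NumberTheory.ModularForms.SiegelSymplecticVolume
import Literature.NumberTheory.ModularForms.SiegelCayleyBiholomorphic
import Literature.AlgebraicGeometry.Motives.ComplexPointsParacompact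
import Literature.AlgebraicGeometry.Motives.ComplexPointsManifold
import Literature.AlgebraicGeometry.ModuliOfAbelianVarieties.SiegelClassifyingMapLocalInverse
import Summits.HodgeConjecture.HodgeConjecture.Theorems.UHeadUa
import Literature.AlgebraicGeometry.Motives.PoincareUniversal.Residual
import HarnessLib

/-!
# E-road brick H0: some smooth open piece of `𝓜_ℂ` with a `ℂ`-point has relative dimension `≥ g(g+1)/2`
# (a Hausdorff-dimension count over the P4-piece socket; EQUIDIM-free, continuity-of-uniformisation-free)

Cell hodgecm-mathlib, E-road «EQUIDIM by proof» (B-plan1 (g13/g14) skeleton `B-plan/F-census/EQUIDIM-skeleton.v1.1`),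
brick H0 `exists_openPiece_le` (B-plan1 (g14) 18:51:09Z; hand B-p13 (g16)).  THEOREMS ONLY, `--as helper` capital for
`stmt-HodgeConjecture-24835` (count-neutral).  HC_CM is proved only modulo the 7 printed citations until rung 0 closes.

## The mathematics

Let `𝓜 = 𝓜_{g,δ,N}` be a Siegel fine moduli scheme over `ℚ` (type `δ`, full level `N ≥ 3`, `g ≥ 1`) with `𝓜` smooth and
quasi-projective ((F)).  `𝓜_ℂ` is a finite disjoint union of clopen pieces `E_c`, each smooth of some pure relative dimension
`d_c` and quasi-projective (★ `UnivFamilyHodgeFrames.exists_smooth_pieces_baseChange_M`).  CLAIM: some piece with a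
`ℂ`-point has `g(g+1)/2 ≤ d_c`.  Inputs: (P4-piece) around every complex point `t` of a piece whose classifying point carries a
triple admissible at `(Z, r)` (`r` principal) there is an open `W ∋ t` and a chart-holomorphic `π : W → 𝔥_g` reading
admissibility at `r` (the G-AN1 socket TEXT, hypothesis `hP4`); (U-a at one component) every `Z ∈ 𝔥_g` is the period point at
`r = 1` of SOME triple (hypothesis `hUa`; = ★ `UHeadUa.Ua_holds_of_residual (U_a3_residual_of_M13)` at `(c, u, r) = (1, 1, 1)`).
PROOF (Hausdorff dimension; [Mattila1995] Thm. 7.5): the points `t` whose classifying point is `r = 1`-admissible form a set `Y_c`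
covered by the P4-piece opens `W_t`; `E_c(ℂ)` is second countable (quasi-projective), so countably many `W_{t_i}` cover `Y_c`,
and countably many algebraic chart sources cover each `W_{t_i}`.  For `Z ∈ 𝔥_g` with triple `P_Z` (admissible at `(Z, 1)`),
its classifying point lies on some piece, `= e_c(t₀)`, `t₀ ∈ Y_c ⊆ ⋃ W_{t_i}`; the reading clause at `t₀` produces `P′`
admissible at `(π_i t₀, 1)` with the SAME classifying point, so `P_Z` is admissible at `(π_i t₀, 1)` as well (★
`SiegelFineModuliScheme.isAdmissibleAt_of_classifyingMap_eq`) and [Milne2005ShimuraVarieties] Lemma 5.13 (★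
`exists_siegelLevelGroup_smul_of_isAdmissibleAt`) gives `Z = M • π_i t₀` for some `M ∈ Γ_δ(N) ⊆ Sp_δ(ℤ)` (countable).  Hence
`𝔥_g`, read in Klingen's coordinates `ℂ^{g(g+1)/2}` (★ `coordUHS`, open range), is contained in the COUNTABLE union over
`(c, i, chart x, M)` of the images of the holomorphic maps `v ↦ sym(M • π_i(chart_x⁻¹ v))` of opens of `ℂ^{d_c}`, each of
Hausdorff dimension `≤ 2 d_c` (★ `Euclidean.dimH_image_le_finrank_of_contDiffOn` after Osgood).  If every piece with a
`ℂ`-point had `d_c < g(g+1)/2`, the union would have dimension `≤ g(g+1) − 2 < g(g+1) = dimH 𝔥_g` — contradiction.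

This discharges the «∃ thick piece» half of the residual `stub_noThinPiece` WITHOUT any continuity of the inverse
uniformisation `Z ↦ y_r(Z)` (the EQUIDIM-equivalent input) and without deformation theory; the «every piece» half is the
planner's Hecke-link road.

## References
* [Mattila1995] P. Mattila, *Geometry of Sets and Measures in Euclidean Spaces* (1995), Thm. 7.5.
* [Milne2005ShimuraVarieties] J. S. Milne, *Introduction to Shimura Varieties* (2005), §6 Thm. 6.11, Lemma 5.13.
* [MumfordFogartyKirwan1994] D. Mumford, J. Fogarty, F. Kirwan, *GIT* (3rd ed. 1994), Appendix to Ch. 7 §A (p. 235).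
* [Klingen1990] H. Klingen, *Introductory lectures on Siegel modular forms* (1990), Ch. I §1 Def. 2, Prop. 1.
-/

set_option autoImplicit false
set_option linter.dupNamespace false  -- `Summit.HodgeConjecture.HodgeConjecture.…` is the cell's layout (D-0017)

noncomputable section

open CategoryTheory CategoryTheory.Limits AlgebraicGeometry Matrix Topology Set
open scoped ENNReal Matrix.Norms.Elementwise
open Literature.AlgebraicGeometry
open Literature.AlgebraicGeometry.Motives (SchemeOver ComplexPoints AlgPoints specOver)
open Literature.AlgebraicGeometry.AbelianSchemes (PolarizedAbelianSchemeWithLevel)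
open Literature.AlgebraicGeometry.HodgeTheory (IsQuasiProjectiveOver)
open Literature.AlgebraicGeometry.ModuliOfAbelianVarieties
open Literature.NumberTheory.Automorphic (siegelUpperHalfSpace)
open Literature.NumberTheory.ModularForms.SiegelUpperHalfSpace
open Literature.NumberTheory.Adeles
open Literature.AlgebraicTopology.SingularHomology (IsClopenPartition)

namespace Summit.HodgeConjecture.HodgeConjecture.Theorems

namespace EquidimThickPiece

open SiegelModuli

/-! ## §1 Two dimension counts -/

/-- **A holomorphic image of an open of `ℂᵈ` has Hausdorff dimension `≤ 2d`** (Osgood ★ `SCV.analyticOnNhd_of_differentiableOn` ⇒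
`C¹`; ★ `Euclidean.dimH_image_le_finrank_of_contDiffOn`: `C¹` maps are locally Lipschitz and do not raise Hausdorff dimension).
[cite: Mattila1995, Thm. 7.5] -/
theorem dimH_image_le_of_differentiableOn {d : ℕ} {F : Type*} [NormedAddCommGroup F] [NormedSpace ℂ F]
    [FiniteDimensional ℂ F] {f : (Fin d → ℂ) → F} {U : Set (Fin d → ℂ)} (hU : IsOpen U)
    (hf : DifferentiableOn ℂ f U) : dimH (f '' U) ≤ ((2 * d : ℕ) : ℝ≥0∞) := by
  haveI : CompleteSpace F := FiniteDimensional.complete ℂ F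
  letI : NormedSpace ℝ F := NormedSpace.restrictScalars ℝ ℂ F
  haveI : FiniteDimensional ℝ F := Module.Finite.trans ℂ F
  have han := Literature.Analysis.Complex.SCV.analyticOnNhd_of_differentiableOn hf hU
  have hc : ContDiffOn ℝ 1 f U := (han.contDiffOn_of_completeSpace (n := 1)).restrict_scalars ℝ
  have h := Literature.Topology.Euclidean.dimH_image_le_finrank_of_contDiffOn hU hc
  have hfr : Module.finrank ℝ (Fin d → ℂ) = 2 * d := by
    rw [finrank_real_of_complex, Module.finrank_fin_fun]
  rwa [hfr] at h

/-- **`dimH 𝔥_g = g(g+1)` in Klingen's coordinates**: the range of ★ `coordUHS : 𝔥_g → ℂ^{g(g+1)/2}` is open (★ `range_coordUHS`,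
★ `isOpen_siegelUpperHalfSpaceCoord`) and non-empty (★ `pointI`), so its Hausdorff dimension is the real dimension of the
ambient space (Mathlib `Real.dimH_of_nonempty_interior`; ★ `SiegelLocalInverse.finrank_sym2_fun`). [cite: Klingen1990, Ch. I §1 Def. 2 (p. 2)] [cite: Mattila1995, Thm. 7.5] -/
theorem dimH_range_coordUHS (g : ℕ) :
    dimH (Set.range (coordUHS : siegelUpperHalfSpace g → Sym2 (Fin g) → ℂ)) = ((2 * (g * (g + 1) / 2) : ℕ) : ℝ≥0∞) := by
  have hopen : IsOpen (Set.range (coordUHS : siegelUpperHalfSpace g → Sym2 (Fin g) → ℂ)) := by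
    rw [range_coordUHS]
    exact isOpen_siegelUpperHalfSpaceCoord
  have hint : (interior (Set.range (coordUHS : siegelUpperHalfSpace g → Sym2 (Fin g) → ℂ))).Nonempty := by
    rw [hopen.interior_eq]
    exact ⟨_, pointI g, rfl⟩
  rw [Real.dimH_of_nonempty_interior hint, finrank_real_of_complex, SiegelLocalInverse.finrank_sym2_fun]

/-! ## §2 The thick piece -/

/-- **BRICK H0 — SOME SMOOTH OPEN PIECE OF `𝓜_ℂ` WITH A `ℂ`-POINT HAS RELATIVE DIMENSION `≥ g(g+1)/2`** (for (F), the P4-piece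
socket and U-a at the component `r = 1`).  Hausdorff-dimension count, see the module docstring: the finitely many smooth
quasi-projective clopen pieces (★ `exists_smooth_pieces_baseChange_M`), countably many P4-piece period charts on each
(second countability of `E_c(ℂ)`), the `Γ_δ(N)`-ambiguity of the period point of ONE triple (★
`exists_siegelLevelGroup_smul_of_isAdmissibleAt`, transported along equal classifying points by ★
`SiegelFineModuliScheme.isAdmissibleAt_of_classifyingMap_eq`), and `dimH 𝔥_g = g(g+1)` against `dimH ≤ 2 d_c` for holomorphic
images of opens of `ℂ^{d_c}`.  The hypothesis `hP4` is the P4-piece socket TEXT (B-p03 (g14) `P4piece-text.v1` 0225915a,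
kernel-green by paste as `UHead.Ue_P4_piece_holds_modF`); `hUa` is U-a at `(c, u, r) = (1, 1, 1)`
(★ `UHeadUa.Ua_holds_of_residual (Motives.AbelianVariety.U_a3_residual_of_M13)`).
[cite: Mattila1995, Thm. 7.5] [cite: Milne2005ShimuraVarieties, §6 Thm. 6.11 pp. 74–75, Lemma 5.13 p. 57]
[cite: MumfordFogartyKirwan1994, Appendix to Ch. 7 §A (p. 235)] -/
theorem exists_openPiece_le (hF : lan2013_siegelFineModuliScheme)
    (hP4 : ∀ (g N : ℕ) (δ : Fin g → ℕ) (_hg : 0 < g) (hδ : IsPolarizationType δ) (_hN : 3 ≤ N)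
      (𝓜 : SiegelFineModuliScheme g N δ) (r : gspFinAdelic δ)
      {S' : SchemeOver ℂ} (ι : S' ⟶ (Motives.baseChange ℚ ℂ).obj 𝓜.M) [IsOpenImmersion ι.left]
      (_hSq : HodgeTheory.IsQuasiProjectiveOver S')
      (d : ℕ) [SmoothOfRelativeDimension d S'.hom],
      haveI : IsLocallyNoetherian (specOver ℚ ℂ).left :=
        inferInstanceAs (IsLocallyNoetherian (Spec (CommRingCat.of ℂ)))
      haveI : Smooth S'.hom := SmoothOfRelativeDimension.smooth d _
      haveI : LocallyOfFiniteType S'.hom := inferInstance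
      r ∈ principalLevelSubgroup δ 1 →
      ∀ (Z₀ : Matrix (Fin g) (Fin g) ℂ) (hZ₀ : Z₀ ∈ siegelUpperHalfSpace g)
        (P₀ : PolarizedAbelianSchemeWithLevel g N δ (specOver ℚ ℂ).left), IsAdmissibleAt hδ r Z₀ hZ₀ P₀ →
      ∀ (t₀ : ComplexPoints S'),
        AlgPoints.map (L := ℂ) ι t₀ =
          AlgPoints.baseChangeEquiv (algebraMap ℚ ℂ) 𝓜.M (𝓜.classifyingMap (specOver ℚ ℂ) P₀) →
      ∃ (W : Set (ComplexPoints S')) (π : ComplexPoints S' → Matrix (Fin g) (Fin g) ℂ),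
        IsOpen W ∧ t₀ ∈ W ∧ π t₀ = Z₀ ∧ ContinuousOn π W ∧
        (∀ x ∈ W, ∀ (i j : Fin g),
          DifferentiableOn ℂ
            ((fun y ↦ π y i j) ∘ (ComplexPoints.algebraicChart S' d x).symm)
            ((ComplexPoints.algebraicChart S' d x).target ∩ (ComplexPoints.algebraicChart S' d x).symm ⁻¹' W)) ∧
        (∀ x ∈ W, ∃ hx : π x ∈ siegelUpperHalfSpace g,
          ∃ P' : PolarizedAbelianSchemeWithLevel g N δ (specOver ℚ ℂ).left,
            IsAdmissibleAt hδ r (π x) hx P' ∧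
            AlgPoints.baseChangeEquiv (algebraMap ℚ ℂ) 𝓜.M (𝓜.classifyingMap (specOver ℚ ℂ) P') = AlgPoints.map (L := ℂ) ι x))
    (g N : ℕ) (δ : Fin g → ℕ) (hg : 0 < g) (hδ : IsPolarizationType δ) (hN : 3 ≤ N)
    (𝓜 : SiegelFineModuliScheme g N δ)
    (hUa : ∀ (Z : Matrix (Fin g) (Fin g) ℂ) (hZ : Z ∈ siegelUpperHalfSpace g),
      ∃ P' : PolarizedAbelianSchemeWithLevel g N δ (specOver ℚ ℂ).left, IsAdmissibleAt hδ 1 Z hZ P') :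
    ∃ (S' : SchemeOver ℂ) (ι : S' ⟶ (Motives.baseChange ℚ ℂ).obj 𝓜.M) (_ : IsOpenImmersion ι.left)
      (d : ℕ) (_ : SmoothOfRelativeDimension d S'.hom) (q : Spec (CommRingCat.of ℂ) ⟶ S'.left),
      q ≫ S'.hom = 𝟙 _ ∧ g * (g + 1) / 2 ≤ d := by
  classical
  haveI : IsLocallyNoetherian (specOver ℚ ℂ).left := inferInstanceAs (IsLocallyNoetherian (Spec (CommRingCat.of ℂ)))
  set D : ℕ := g * (g + 1) / 2 with hDdef
  obtain ⟨hMs, hMq, -⟩ := W1.smooth_qproj_of_F hF hg hδ hN 𝓜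
  obtain ⟨C, hCfin, E, e, d, hopen, -, hqp, hdim, hpart, -⟩ :=
    UnivFamilyHodgeFrames.exists_smooth_pieces_baseChange_M 𝓜 hMs hMq
  haveI := hCfin
  by_contra hcon
  -- every piece with a `ℂ`-point is thin
  have hthin : ∀ c, Nonempty (ComplexPoints (E c)) → d c + 1 ≤ D := by
    rintro c ⟨t⟩
    by_contra hlt
    haveI := hopen c
    exact hcon ⟨E c, e c, hopen c, d c, hdim c, t.toSpecHom,
      Literature.AlgebraicGeometry.Motives.ComplexPoints.toSpecHom_comp_hom t, by omega⟩
  -- the abbreviations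
  let bce := AlgPoints.baseChangeEquiv (algebraMap ℚ ℂ) 𝓜.M
  -- the set of points of a piece whose classifying point is `r = 1`-admissible
  let Y : ∀ c, Set (ComplexPoints (E c)) := fun c ↦
    {t | ∃ (Z : Matrix (Fin g) (Fin g) ℂ) (hZ : Z ∈ siegelUpperHalfSpace g)
      (P₀ : PolarizedAbelianSchemeWithLevel g N δ (specOver ℚ ℂ).left),
        IsAdmissibleAt hδ 1 Z hZ P₀ ∧ AlgPoints.map (L := ℂ) (e c) t = bce (𝓜.classifyingMap (specOver ℚ ℂ) P₀)}
  -- P4-piece charts around the points of `Y c`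
  have hloc : ∀ (c : C) (t : Y c), ∃ (W : Set (ComplexPoints (E c)))
      (π : ComplexPoints (E c) → Matrix (Fin g) (Fin g) ℂ), IsOpen W ∧ (t : ComplexPoints (E c)) ∈ W ∧
      (haveI : Smooth (E c).hom := SmoothOfRelativeDimension.smooth (d c) _
       haveI : LocallyOfFiniteType (E c).hom := inferInstance
       ∀ x ∈ W, ∀ (i j : Fin g), DifferentiableOn ℂ
        ((fun y ↦ π y i j) ∘ (ComplexPoints.algebraicChart (E c) (d c) x).symm)
        ((ComplexPoints.algebraicChart (E c) (d c) x).target ∩ (ComplexPoints.algebraicChart (E c) (d c) x).symm ⁻¹' W)) ∧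
      (∀ x ∈ W, ∃ hx : π x ∈ siegelUpperHalfSpace g,
        ∃ P' : PolarizedAbelianSchemeWithLevel g N δ (specOver ℚ ℂ).left,
          IsAdmissibleAt hδ 1 (π x) hx P' ∧
          bce (𝓜.classifyingMap (specOver ℚ ℂ) P') = AlgPoints.map (L := ℂ) (e c) x) := by
    rintro c ⟨t, Z, hZ, P₀, hadm, ht⟩
    haveI := hopen c
    haveI := hdim c
    obtain ⟨W, π, hWo, htW, -, -, hhol, hread⟩ :=
      hP4 g N δ hg hδ hN 𝓜 1 (e c) (hqp c) (d c) (Subgroup.one_mem _) Z hZ P₀ hadm t ht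
    exact ⟨W, π, hWo, htW, hhol, hread⟩
  choose W π hWo htW hhol hread using hloc
  -- second countability of the pieces' complex points (quasi-projective)
  have hsc : ∀ c, SecondCountableTopology (ComplexPoints (E c)) := by
    intro c
    obtain ⟨P, j, hP, hj⟩ := hqp c
    haveI := hj
    haveI := Literature.AlgebraicGeometry.Motives.IsProjectiveOver.isProper hP
    exact Literature.AlgebraicGeometry.Motives.ComplexPoints.secondCountableTopology_of_isOpenImmersion (E c) j
  -- countably many charts `W c t`, `t ∈ T c`, cover `Y c`
  have hT : ∀ c, ∃ T : Set (Y c), T.Countable ∧ ⋃ t ∈ T, W c t = ⋃ t, W c t := fun c ↦ by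
    haveI := hsc c
    exact TopologicalSpace.isOpen_iUnion_countable (fun t : Y c ↦ W c t) (fun t ↦ hWo c t)
  choose T hTc hTU using hT
  -- countably many algebraic chart sources at points of `W c t` cover `W c t`
  have hT' : ∀ (c : C) (t : Y c), ∃ S : Set (W c t), S.Countable ∧
      (haveI : Smooth (E c).hom := SmoothOfRelativeDimension.smooth (d c) _
       haveI : LocallyOfFiniteType (E c).hom := inferInstance
       ⋃ x ∈ S, (ComplexPoints.algebraicChart (E c) (d c) (x : ComplexPoints (E c))).source =
         ⋃ x : W c t, (ComplexPoints.algebraicChart (E c) (d c) (x : ComplexPoints (E c))).source) := by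
    intro c t
    haveI := hsc c
    haveI := hdim c
    haveI : Smooth (E c).hom := SmoothOfRelativeDimension.smooth (d c) _
    haveI : LocallyOfFiniteType (E c).hom := inferInstance
    exact TopologicalSpace.isOpen_iUnion_countable
      (fun x : W c t ↦ (ComplexPoints.algebraicChart (E c) (d c) (x : ComplexPoints (E c))).source)
      (fun x ↦ (ComplexPoints.algebraicChart (E c) (d c) (x : ComplexPoints (E c))).open_source)
  choose T' hT'c hT'U using hT'
  -- instances on the pieces
  haveI hOI : ∀ c, IsOpenImmersion (e c).left := hopen
  haveI hSRD : ∀ c, SmoothOfRelativeDimension (d c) (E c).hom := hdim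
  haveI hSm : ∀ c, Smooth (E c).hom := fun c ↦ SmoothOfRelativeDimension.smooth (d c) _
  haveI hLFT : ∀ c, LocallyOfFiniteType (E c).hom := fun c ↦ inferInstance
  haveI : Countable (Matrix (Fin g ⊕ Fin g) (Fin g ⊕ Fin g) ℤ) :=
    inferInstanceAs (Countable (Fin g ⊕ Fin g → Fin g ⊕ Fin g → ℤ))
  haveI : Countable (GL (Fin g ⊕ Fin g) ℤ) :=
    Function.Injective.countable
      (f := (Units.val : GL (Fin g ⊕ Fin g) ℤ → Matrix (Fin g ⊕ Fin g) (Fin g ⊕ Fin g) ℤ)) fun a b h ↦ Units.ext h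
  -- the holomorphic maps whose images cover `𝔥_g` in Klingen's coordinates
  let Mt : symplecticLatticeGroup δ → Matrix (Fin g ⊕ Fin g) (Fin g ⊕ Fin g) ℂ := fun M ↦
    ((gDHom δ hδ.1 M : Matrix.symplecticGroup (Fin g) ℝ) : Matrix (Fin g ⊕ Fin g) (Fin g ⊕ Fin g) ℝ).map
      ((↑) : ℝ → ℂ)
  let sym : Matrix (Fin g) (Fin g) ℂ → (Sym2 (Fin g) → ℂ) := fun Z s ↦
    Sym2.lift ⟨fun i j ↦ (2 : ℂ)⁻¹ * (Z i j + Z j i), fun i j ↦ by ring⟩ s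
  let ch : ∀ c, ComplexPoints (E c) → OpenPartialHomeomorph (ComplexPoints (E c)) (Fin (d c) → ℂ) :=
    fun c x ↦ ComplexPoints.algebraicChart (E c) (d c) x
  let U : ∀ c, Y c → ComplexPoints (E c) → Set (Fin (d c) → ℂ) := fun c t x ↦
    (ch c x).target ∩ (ch c x).symm ⁻¹' W c t
  let F : ∀ c, Y c → ComplexPoints (E c) → symplecticLatticeGroup δ → (Fin (d c) → ℂ) → (Sym2 (Fin g) → ℂ) :=
    fun c t x M v ↦ sym (moeb (Mt M) (π c t ((ch c x).symm v)))
  let 𝒮 : Set (Sym2 (Fin g) → ℂ) :=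
    ⋃ c, ⋃ t : T c, ⋃ x : T' c t.1, ⋃ M : symplecticLatticeGroup δ,
      F c t.1 (x.1 : ComplexPoints (E c)) M '' U c t.1 (x.1 : ComplexPoints (E c))
  /- (B) every leaf of `𝒮` has Hausdorff dimension `≤ 2 d_c` -/
  have hleaf : ∀ (c : C) (t : Y c) (x : W c t) (M : symplecticLatticeGroup δ),
      dimH (F c t (x : ComplexPoints (E c)) M '' U c t (x : ComplexPoints (E c))) ≤ ((2 * d c : ℕ) : ℝ≥0∞) := by
    intro c t x M
    refine dimH_image_le_of_differentiableOn ((ch c x).isOpen_inter_preimage_symm (hWo c t)) ?_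
    have hG : DifferentiableOn ℂ (fun v ↦ π c t ((ch c x).symm v)) (U c t x) :=
      differentiableOn_pi.2 fun i ↦ differentiableOn_pi.2 fun j ↦ hhol c t x x.2 i j
    have hmaps : MapsTo (fun v ↦ π c t ((ch c x).symm v)) (U c t x) (siegelUpperHalfSpace g) :=
      fun v hv ↦ (hread c t _ hv.2).1
    have hmo : DifferentiableOn ℂ (moeb (Mt M)) (siegelUpperHalfSpace g) :=
      differentiableOn_moeb_of_mem (gDHom δ hδ.1 M).2
    have hcomp := hmo.comp hG hmaps
    refine differentiableOn_pi.2 fun s ↦ ?_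
    induction s using Sym2.ind with
    | _ i j =>
      have h1 := differentiableOn_pi.1 (differentiableOn_pi.1 hcomp i) j
      have h2 := differentiableOn_pi.1 (differentiableOn_pi.1 hcomp j) i
      have h3 := (h1.add h2).const_mul (2 : ℂ)⁻¹
      refine h3.congr fun v _ ↦ ?_
      simp only [F, sym, Sym2.lift_mk, Pi.add_apply, Function.comp_apply]
  /- (A) `𝔥_g` in coordinates is covered by `𝒮` -/
  have hcover : Set.range (coordUHS : siegelUpperHalfSpace g → Sym2 (Fin g) → ℂ) ⊆ 𝒮 := by
    rintro _ ⟨z, rfl⟩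
    obtain ⟨PZ, hPZ⟩ := hUa z.1 z.2
    obtain ⟨c, t₀, ht₀⟩ := hpart.exists_mem (bce (𝓜.classifyingMap (specOver ℚ ℂ) PZ))
    have hY : t₀ ∈ Y c := ⟨z.1, z.2, PZ, hPZ, ht₀⟩
    have hmemW : t₀ ∈ ⋃ t ∈ T c, W c t := by
      rw [hTU c]
      exact Set.mem_iUnion.2 ⟨⟨t₀, hY⟩, htW c ⟨t₀, hY⟩⟩
    obtain ⟨t, htT, ht₀W⟩ := Set.mem_iUnion₂.1 hmemW
    obtain ⟨hπ, P', hP'adm, hP'cls⟩ := hread c t t₀ ht₀W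
    have hcls : 𝓜.classifyingMap (specOver ℚ ℂ) PZ = 𝓜.classifyingMap (specOver ℚ ℂ) P' :=
      bce.injective (by rw [hP'cls, ht₀])
    have hPZ' : IsAdmissibleAt hδ 1 (π c t t₀) hπ PZ :=
      𝓜.isAdmissibleAt_of_classifyingMap_eq hδ P' PZ hP'adm hcls
    obtain ⟨M, -, hM⟩ :=
      exists_siegelLevelGroup_smul_of_isAdmissibleAt hg hδ hN (Subgroup.one_mem _) z.2 hπ PZ hPZ hPZ'
    have hmemS : t₀ ∈ ⋃ x ∈ T' c t, (ch c (x : ComplexPoints (E c))).source := by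
      rw [hT'U c t]
      exact Set.mem_iUnion.2 ⟨⟨t₀, ht₀W⟩, ComplexPoints.mem_algebraicChart_source _ _ _⟩
    obtain ⟨x, hxT, hx⟩ := Set.mem_iUnion₂.1 hmemS
    refine Set.mem_iUnion.2 ⟨c, Set.mem_iUnion.2 ⟨⟨t, htT⟩, Set.mem_iUnion.2 ⟨⟨x, hxT⟩,
      Set.mem_iUnion.2 ⟨M, ?_⟩⟩⟩⟩
    refine ⟨ch c x t₀, ⟨(ch c x).map_source hx, ?_⟩, ?_⟩
    · show (ch c x).symm (ch c x t₀) ∈ W c t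
      rw [(ch c x).left_inv hx]
      exact ht₀W
    · have hsymm : (ch c (x : ComplexPoints (E c))).symm (ch c (x : ComplexPoints (E c)) t₀) = t₀ :=
        (ch c x).left_inv hx
      have hZ : moeb (Mt M) (π c t t₀) = (z : Matrix (Fin g) (Fin g) ℂ) := by
        have h := congrArg (fun w : siegelUpperHalfSpace g ↦ (w : Matrix (Fin g) (Fin g) ℂ)) hM
        simpa only [coe_smul] using h.symm
      funext s
      induction s using Sym2.ind with
      | _ i j =>
        simp only [F, sym, hsymm, hZ, Sym2.lift_mk, coordUHS_apply_mk]
        rw [z.2.1.apply i j]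
        ring
  /- (C) the count -/
  have hdimS : dimH 𝒮 ≤ ((2 * (g * (g + 1) / 2) - 2 : ℕ) : ℝ≥0∞) := by
    refine (dimH_iUnion _).trans_le (iSup_le fun c ↦ ?_)
    haveI := (hTc c).to_subtype
    refine (dimH_iUnion _).trans_le (iSup_le fun t ↦ ?_)
    haveI := (hT'c c t.1).to_subtype
    refine (dimH_iUnion _).trans_le (iSup_le fun x ↦ ?_)
    refine (dimH_iUnion _).trans_le (iSup_le fun M ↦ ?_)
    refine (hleaf c t.1 x.1 M).trans ?_
    have hth := hthin c ⟨(t.1 : ComplexPoints (E c))⟩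
    exact_mod_cast (by omega : 2 * d c ≤ 2 * (g * (g + 1) / 2) - 2)
  have hle := (dimH_mono hcover).trans hdimS
  rw [dimH_range_coordUHS] at hle
  have hnat : 2 * (g * (g + 1) / 2) ≤ 2 * (g * (g + 1) / 2) - 2 := by exact_mod_cast hle
  have h2 : 2 ≤ g * (g + 1) := by nlinarith
  generalize hk : g * (g + 1) = k at hnat h2
  omega

/-! ## §3 U-a at the unit component is a tree theorem; H0 from (F) and the P4-piece socket alone -/

/-- **Every point of `𝔥_g` is the period point AT `r = 1` of some polarised abelian scheme with level structure over `ℂ`**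
(U-a ★ `UHead.Ua_holds_of_residual` over M13 ★ `Motives.AbelianVariety.U_a3_residual_of_M13`, at the residue datum
`(c, u, r) = (1, 1, 1)`: `Valued.v (1 v) = 1`, `1 - 1 ∈ levelIdeal N`, `1 ∈ K_δ(1)`, ★ `IsMultiplier.one`, `fromBlocks 1 0 0 1 = 1`).
[cite: Milne2005ShimuraVarieties, §6 Thm. 6.11 pp. 74–75] [cite: MumfordFogartyKirwan1994, Appendix to Ch. 7 §A (p. 235)] -/
theorem exists_isAdmissibleAt_one {g N : ℕ} {δ : Fin g → ℕ} (hg : 0 < g) (hδ : IsPolarizationType δ) (hN : 3 ≤ N)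
    (Z : Matrix (Fin g) (Fin g) ℂ) (hZ : Z ∈ siegelUpperHalfSpace g) :
    ∃ P' : PolarizedAbelianSchemeWithLevel g N δ (specOver ℚ ℂ).left, IsAdmissibleAt hδ 1 Z hZ P' := by
  haveI : Fact (1 < N) := ⟨by omega⟩
  refine UHead.Ua_holds_of_residual Motives.AbelianVariety.U_a3_residual_of_M13 g N δ hg hδ hN 1 1 1
    (fun v ↦ by rw [Units.val_one, show (1 : finAdeleQ) v = 1 from rfl, Valuation.map_one]) ?_
    (Subgroup.one_mem _) ?_ ?_ Z hZ
  · rw [Units.val_one, Units.val_one, ZMod.val_one, Nat.cast_one, sub_self]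
    exact zero_mem _
  · rw [OneMemClass.coe_one]
    exact IsMultiplier.one _
  · rw [OneMemClass.coe_one, Units.val_one, Units.val_one, one_smul, Matrix.fromBlocks_one]

/-- **BRICK H0 FROM (F) AND THE P4-PIECE SOCKET ALONE** (`exists_openPiece_le` with U-a discharged by
`exists_isAdmissibleAt_one`): some smooth open piece of `𝓜_ℂ` carrying a `ℂ`-point has relative dimension `≥ g(g+1)/2`.
[cite: Mattila1995, Thm. 7.5] [cite: Milne2005ShimuraVarieties, §6 Thm. 6.11 pp. 74–75, Lemma 5.13 p. 57] -/
theorem exists_openPiece_le' (hF : lan2013_siegelFineModuliScheme)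
    (hP4 : ∀ (g N : ℕ) (δ : Fin g → ℕ) (_hg : 0 < g) (hδ : IsPolarizationType δ) (_hN : 3 ≤ N)
      (𝓜 : SiegelFineModuliScheme g N δ) (r : gspFinAdelic δ)
      {S' : SchemeOver ℂ} (ι : S' ⟶ (Motives.baseChange ℚ ℂ).obj 𝓜.M) [IsOpenImmersion ι.left]
      (_hSq : HodgeTheory.IsQuasiProjectiveOver S')
      (d : ℕ) [SmoothOfRelativeDimension d S'.hom],
      haveI : IsLocallyNoetherian (specOver ℚ ℂ).left :=
        inferInstanceAs (IsLocallyNoetherian (Spec (CommRingCat.of ℂ)))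
      haveI : Smooth S'.hom := SmoothOfRelativeDimension.smooth d _
      haveI : LocallyOfFiniteType S'.hom := inferInstance
      r ∈ principalLevelSubgroup δ 1 →
      ∀ (Z₀ : Matrix (Fin g) (Fin g) ℂ) (hZ₀ : Z₀ ∈ siegelUpperHalfSpace g)
        (P₀ : PolarizedAbelianSchemeWithLevel g N δ (specOver ℚ ℂ).left), IsAdmissibleAt hδ r Z₀ hZ₀ P₀ →
      ∀ (t₀ : ComplexPoints S'),
        AlgPoints.map (L := ℂ) ι t₀ =
          AlgPoints.baseChangeEquiv (algebraMap ℚ ℂ) 𝓜.M (𝓜.classifyingMap (specOver ℚ ℂ) P₀) →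
      ∃ (W : Set (ComplexPoints S')) (π : ComplexPoints S' → Matrix (Fin g) (Fin g) ℂ),
        IsOpen W ∧ t₀ ∈ W ∧ π t₀ = Z₀ ∧ ContinuousOn π W ∧
        (∀ x ∈ W, ∀ (i j : Fin g),
          DifferentiableOn ℂ
            ((fun y ↦ π y i j) ∘ (ComplexPoints.algebraicChart S' d x).symm)
            ((ComplexPoints.algebraicChart S' d x).target ∩ (ComplexPoints.algebraicChart S' d x).symm ⁻¹' W)) ∧
        (∀ x ∈ W, ∃ hx : π x ∈ siegelUpperHalfSpace g,
          ∃ P' : PolarizedAbelianSchemeWithLevel g N δ (specOver ℚ ℂ).left,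
            IsAdmissibleAt hδ r (π x) hx P' ∧
            AlgPoints.baseChangeEquiv (algebraMap ℚ ℂ) 𝓜.M (𝓜.classifyingMap (specOver ℚ ℂ) P') = AlgPoints.map (L := ℂ) ι x))
    (g N : ℕ) (δ : Fin g → ℕ) (hg : 0 < g) (hδ : IsPolarizationType δ) (hN : 3 ≤ N)
    (𝓜 : SiegelFineModuliScheme g N δ) :
    ∃ (S' : SchemeOver ℂ) (ι : S' ⟶ (Motives.baseChange ℚ ℂ).obj 𝓜.M) (_ : IsOpenImmersion ι.left)
      (d : ℕ) (_ : SmoothOfRelativeDimension d S'.hom) (q : Spec (CommRingCat.of ℂ) ⟶ S'.left),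
      q ≫ S'.hom = 𝟙 _ ∧ g * (g + 1) / 2 ≤ d :=
  exists_openPiece_le hF hP4 g N δ hg hδ hN 𝓜 (exists_isAdmissibleAt_one hg hδ hN)

end EquidimThickPiece

end Summit.HodgeConjecture.HodgeConjecture.Theorems

end
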